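import Mathlib
import HarnessLib
import Summits.NavierStokesRegularity.FluidComputer.AngularGalerkinLadderRotation
import Summits.NavierStokesRegularity.NavierStokesRegularity.Theorems.UnthreadedDoorAntidynamoWallSymmetricSector

/-!
# Route `UnthreadedDoor` / `ThreadingFlux`, crux `PoloidalLiouville` (stmt-NavierStokesRegularity-1222), antidynamo v2 skeleton
# (sha16 `4ebf5683127b`): THE WALL'S LETTER ON SYMMETRIC POTENTIALS — `T(t, x₀ + R y) = T(t, x₀ + y)`

Support file (seat leafhand-ns-unthreadeddoor-2 g0, cell decomp-ns), `--supports stmt-NavierStokesRegularity-1222 --as helper`; theorems only.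
Translates `curl_eq_zero_of_curl_symmetric_of_centre_not_fixed_farPast` (p814882, pseudo-symmetric VORTICITY) into the wall's own letter: a
toroidal POTENTIAL `T(t, ·)` INVARIANT under a linear isometry `R` acting about the centre (`T(t, x₀ + R y) = T(t, x₀ + y)`: zonal-with-`Cₙ`,
mirror-symmetric, even, … potentials) represents an `R`-pseudo-symmetric vorticity, `∇T × (x − x₀)` at `x₀ + R y` being `det R • R` of its
value at `x₀ + y` (gradient covariance + the pseudovector law of the cross product, the tree's
`FluidComputer.AngularLadder.cross_map_linearIsometryEquiv`).

* `gradient_comp_symmetric` — `T(x₀ + R y) = T(x₀ + y)` for all `y` ⇒ `∇T(x₀ + R y) = R ∇T(x₀ + y)` (junk values included);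
* ★★ `stubScalarLiouville_of_symmetric_potential_of_centre_not_fixed_farPast` — class + measurability + joint smoothness + the representation
  `curl v = ∇T × (x − x₀)` + `T(t, ·)` `R`-invariant about `x₀` at every `t < 0` + `R v(t, x₀) ≠ v(t, x₀)` on a far past ⇒ `∇T × (x − x₀) ≡ 0`.

HONEST LABEL: a sector of the wall in its own letter; the genuinely `R`-symmetric cores (centre velocity fixed by `R` at times `tₙ → −∞`) stay
OPEN; nothing here proves `stub_scalarLiouville`, `PoloidalLiouville` (1222), or bears on Navier–Stokes regularity; no summit statement is proved.
[folklore] [cite: KochNadirashviliSereginSverak2009, Thm 5.2 (arXiv:0709.3599 pp. 9–10)]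
-/

noncomputable section

-- the summit and its single sub-problem share the name (CONVENTIONS §1)
set_option linter.dupNamespace false

open scoped Topology InnerProductSpace RealInnerProductSpace ContDiff
open Filter Set Function Metric MeasureTheory
open Literature.Analysis.FluidPDE

namespace Summit.NavierStokesRegularity.NavierStokesRegularity.Theorems.PoloidalLiouville.Antidynamo

/-! ### Gradient covariance for a symmetric potential -/

/-- **A potential invariant under `y ↦ x₀ + R (y − x₀)` has an `R`-covariant gradient**: if `T(x₀ + R y) = T(x₀ + y)` for all `y`, then
`∇T(x₀ + R y) = R (∇T(x₀ + y))` (junk values included: both chain rules hold unconditionally for the affine isometry). [folklore] -/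
theorem gradient_comp_symmetric {T : EuclideanSpace ℝ (Fin 3) → ℝ} {x₀ : EuclideanSpace ℝ (Fin 3)}
    (R : EuclideanSpace ℝ (Fin 3) ≃ₗᵢ[ℝ] EuclideanSpace ℝ (Fin 3)) (hT : ∀ y, T (x₀ + R y) = T (x₀ + y)) (y : EuclideanSpace ℝ (Fin 3)) :
    gradient T (x₀ + R y) = R (gradient T (x₀ + y)) := by
  -- the two chain rules
  have h1 : fderiv ℝ (fun z : EuclideanSpace ℝ (Fin 3) => T (x₀ + R z)) y =
      (fderiv ℝ T (x₀ + R y)).comp (R.toContinuousLinearEquiv : EuclideanSpace ℝ (Fin 3) →L[ℝ] EuclideanSpace ℝ (Fin 3)) := by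
    have e : (fun z : EuclideanSpace ℝ (Fin 3) => T (x₀ + R z)) = (fun w => T (x₀ + w)) ∘ (R.toContinuousLinearEquiv) := by
      funext z; rfl
    rw [e, ContinuousLinearEquiv.comp_right_fderiv, fderiv_comp_add_left]
    rfl
  have h2 : fderiv ℝ (fun z : EuclideanSpace ℝ (Fin 3) => T (x₀ + R z)) y = fderiv ℝ T (x₀ + y) := by
    have e : (fun z : EuclideanSpace ℝ (Fin 3) => T (x₀ + R z)) = fun z => T (x₀ + z) := funext hT
    rw [e, fderiv_comp_add_left]
  have h3 : ∀ h : EuclideanSpace ℝ (Fin 3), fderiv ℝ T (x₀ + R y) h = fderiv ℝ T (x₀ + y) (R.symm h) := by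
    intro h
    have := congrArg (fun L : EuclideanSpace ℝ (Fin 3) →L[ℝ] ℝ => L (R.symm h)) (h1.symm.trans h2)
    simpa using this
  -- pass to gradients through the inner product
  apply ext_inner_right ℝ
  intro h
  rw [Literature.Analysis.FluidPDE.inner_gradient_left, h3 h, ← Literature.Analysis.FluidPDE.inner_gradient_left,
    ← R.inner_map_map (gradient T (x₀ + y)) (R.symm h), R.apply_symm_apply]

/-! ### ★★ The wall's letter on symmetric potentials -/

/-- **An `R`-invariant potential represents an `R`-pseudo-symmetric vorticity**: if `curl (v t) x = ∇T × (x − x₀)` everywhere and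
`T(x₀ + R y) = T(x₀ + y)` for all `y`, then `curl (v t)(x₀ + R y) = det R • R (curl (v t)(x₀ + y))`. [folklore] -/
theorem curl_symmetric_of_symmetric_potential {V : EuclideanSpace ℝ (Fin 3) → EuclideanSpace ℝ (Fin 3)}
    {T : EuclideanSpace ℝ (Fin 3) → ℝ} {x₀ : EuclideanSpace ℝ (Fin 3)}
    (hrep : ∀ x, curl V x = cross (gradient T x) (x - x₀))
    (R : EuclideanSpace ℝ (Fin 3) ≃ₗᵢ[ℝ] EuclideanSpace ℝ (Fin 3)) (hT : ∀ y, T (x₀ + R y) = T (x₀ + y))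
    (y : EuclideanSpace ℝ (Fin 3)) :
    curl V (x₀ + R y) = (R : EuclideanSpace ℝ (Fin 3) →L[ℝ] EuclideanSpace ℝ (Fin 3)).det • R (curl V (x₀ + y)) := by
  rw [hrep, hrep, add_sub_cancel_left, add_sub_cancel_left, gradient_comp_symmetric R hT y,
    Summit.NavierStokesRegularity.FluidComputer.AngularLadder.cross_map_linearIsometryEquiv]

/-- ★★ **THE WALL ON SYMMETRIC POTENTIALS WHOSE CENTRE VELOCITY BREAKS THE SYMMETRY.**  Let `v` be a bounded ancient mild solution
(`ν = 1`, duality class) with measurable slices, jointly smooth on `(−∞,0) × ℝ³`, whose vorticity is represented by a toroidal potential,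
`curl (v t) x = ∇T(t, x) × (x − x₀)`, with `T(t, ·)` INVARIANT under a linear isometry `R` acting about `x₀` (`T(t, x₀ + R y) = T(t, x₀ + y)`)
at every `t < 0`.  If `R v(t, x₀) ≠ v(t, x₀)` for all `t < t₁` (some `t₁ ≤ 0`), then `∇T(t, x) × (x − x₀) = 0` for all `t < 0`, `x` — the
conclusion of the registered wall `StubScalarLiouville` on this sector, without (E1), the bound or the smoothness of `T`.  Instances: `R = σ`
(even `T`, residual `v(t, x₀) = 0`), `R` a rotation by `2π/n` about an axis `a ∋ x₀` (`Cₙ`-symmetric `T`, residual `v(t, x₀) ∥ a`), `R` a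
reflection in a plane `Π ∋ x₀` (mirror-symmetric `T`, residual `v(t, x₀) ∈ Π`). [cite: KochNadirashviliSereginSverak2009, Thm 5.2 (arXiv:0709.3599 pp. 9–10)] -/
theorem stubScalarLiouville_of_symmetric_potential_of_centre_not_fixed_farPast
    (v : ℝ → EuclideanSpace ℝ (Fin 3) → EuclideanSpace ℝ (Fin 3)) (x₀ : EuclideanSpace ℝ (Fin 3))
    (T : ℝ → EuclideanSpace ℝ (Fin 3) → ℝ)
    (hB : Literature.Analysis.FluidPDE.IsBoundedAncientMildSolution 1 v)
    (hm : ∀ t < 0, AEStronglyMeasurable (v t) volume)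
    (hsm : ContDiffOn ℝ (⊤ : ℕ∞) (Function.uncurry v) (Set.Iio 0 ×ˢ Set.univ))
    (hrep : ∀ t < 0, ∀ x, Literature.Analysis.FluidPDE.curl (v t) x =
      Literature.Analysis.FluidPDE.cross (gradient (T t) x) (x - x₀))
    (R : EuclideanSpace ℝ (Fin 3) ≃ₗᵢ[ℝ] EuclideanSpace ℝ (Fin 3))
    (hTsym : ∀ t < 0, ∀ y, T t (x₀ + R y) = T t (x₀ + y))
    (hne : ∃ t₁ ≤ 0, ∀ t < t₁, R (v t x₀) ≠ v t x₀) :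
    ∀ t < 0, ∀ x, Literature.Analysis.FluidPDE.cross (gradient (T t) x) (x - x₀) = 0 :=
  stubScalarLiouville_of_curl_symmetric_of_centre_not_fixed_farPast v x₀ T hB hm hsm hrep R
    (fun t ht => curl_symmetric_of_symmetric_potential (hrep t ht) R (hTsym t ht)) hne

end Summit.NavierStokesRegularity.NavierStokesRegularity.Theorems.PoloidalLiouville.Antidynamo

end
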